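/-
Copyright (c) 2026 the pub-hodgecm-mathlib formalisation cell (harness21).  Prover seat hodgecm-mathlib-K2E3-p17 (g9), Track B «K2-LIT» / h413
(`stmt-HodgeConjecture-24833`), line `K2_E3_EllipticInputs`, leaf (nsc-S-A'), D120 brick IRR''-c2 «Kill», part (K-b): «no cuspidal vectors in `r_Q` of a subquotient of a
representation carrying the cell hypothesis», in the `Bool` currency of ★ BRIDGE ∕ ★ IRR''-c1.  2026-09-04.
-/
import Summits.HodgeConjecture.HodgeConjecture.Theorems.K2E3GL3JacquetLeviRelabel            -- (K-a) (this seat): `exists_leviRelabel`, `exists_jacquetRelabel`, `jacquetRelabel_jacquetGL`, `mem_cutUnipotent_of_blockDiagonalGL_mem`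
import Summits.HodgeConjecture.HodgeConjecture.Theorems.K2E3JacquetSubquotientNoCuspidal       -- ★ LIFT (K2E3-p17 g8): `intertwiningMap_subrepresentation_jacquetGL_eq_zero`
import Summits.HodgeConjecture.HodgeConjecture.Theorems.K2E3GL3JacquetInStagesBorel           -- ★ E2-J F2 (K2E3-p14): stages map `p`, `mem_coinvariantsKer_subrepresentation_iff`, `blockDiagonalGL_mulSingle_false_mem_unipotentRadicalGL`
import Summits.HodgeConjecture.HodgeConjecture.Theorems.K2E3GL3ExponentRules                  -- ★ H0 (K2E3-p25): `isSmooth_normalizedJacquetGL`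
import Summits.HodgeConjecture.HodgeConjecture.Theorems.K2E3GL3OuterAutomorphismInduction     -- ★ T1 (K2E3-p21): `mem_unipotentRadicalP_iff`
import Literature.NumberTheory.Automorphic.ParabolicInductionCuspidalSupportProofs              -- ★ `isSupercuspidal_of_forall_cut`
import Literature.NumberTheory.Automorphic.ParabolicInductionQuotientProofs                     -- ★ `exists_isCoatom_subrepresentation`, `isIrreducible_quotientRep`, `IsSmooth.quotientRep`
import Literature.NumberTheory.Automorphic.ParabolicInductionAdmissibleProofs                   -- ★ `isIrreducible_comp_of_surjective`
import Literature.NumberTheory.Automorphic.ParabolicGLReindex                                   -- ★ `IsSmooth.comp_of_continuous`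
import Literature.NumberTheory.Automorphic.AdmissibleSubquotient                                -- ★ `IsSmooth.toRepresentation`
import HarnessLib

/-!
# Crux `H413` — leaf (nsc-S-A′), brick IRR″-c2 (K-b): NO CUSPIDAL VECTORS IN `r_Q ρ` FOR A SUBQUOTIENT `ρ` OF A REPRESENTATION CARRYING THE CELL HYPOTHESIS (`Bool` currency)

Cell `hodgecm-mathlib`, Track B; THEOREMS ONLY; count-neutral helper (`--supports stmt-HodgeConjecture-24833 --as helper`).  `Q = P_{(2,1)}` labelled `![false,false,true]` (★ BRIDGE ∕
★ STD-EMB ∕ ★ IRR″-c1 currency), `M = GL₂ × GL₁` its block Levi, `ι = ι_e : GL₂(F) → M` the block embedding, `p : r_Q ρ ↠ r_B ρ` ★ p14's stages map (`[x]_Q ↦ [x]_B`).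
Let `I` be smooth and carry the cell hypothesis `hcell` at the `Fin 2`-labelling `c = ![0,0,1]` (the binder `h3cell` of ★ E4a ∕ ★ IRR″-b specialised to `c`; paid by ★ (CELL-3)),
and let `ρ` be smooth, presented as a subquotient `ρ₁ ↪ I`, `ρ₁ ↠ ρ`.
* **`subrepresentation_eq_bot_of_stagesMap_eq_zero`**: a FINITELY GENERATED `M`-subrepresentation `W₂ ≤ r_Q ρ` (unnormalised action `jacquetGL`) all of whose vectors die under `p`
  is `⊥`.  Proof: a maximal proper `N₂ < W₂` (★ `exists_isCoatom_subrepresentation`) has an irreducible smooth quotient `σ = W₂ ⁄ N₂`; by ★ p14's left exactness in the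
  `GL₂`-slot (`mem_coinvariantsKer_subrepresentation_iff`) every vector of `W₂` lies in the `U₂`-coinvariant kernel of `W₂ ∘ ι`, so `σ` transported to the `Fin 2`-Levi along
  (K-a)'s `φ` has vanishing cut-Jacquet module (`ι(U₂)` ↦ `cutUnipotent F ![0,0,1] 0`, (K-a) §3) and is SUPERCUSPIDAL (★ `isSupercuspidal_of_forall_cut`); transporting `W₂` along
  (K-a)'s `Θ : r_Q^{Bool} ρ ≃ r_Q^{Fin} ρ` gives a `Fin 2`-currency `M`-subrepresentation `W′ ≤ jacquetGL F ![0,0,1] ρ` with a NON-ZERO intertwining map `W′ ↠ σ ∘ φ` — contradicting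
  ★ LIFT §1 `intertwiningMap_subrepresentation_jacquetGL_eq_zero` (Casselman's Cor. 5.4.3 pulled back to subquotients).
* **`eq_zero_of_stagesMap_cyclic_eq_zero`**: CYCLIC FORM — a vector `x ∈ r_Q ρ` whose cyclic `M`-span dies under `p` is `0` (`ℂ[M]·x` is finitely generated,
  Mathlib `Module.Finite.span_singleton` ∕ `Subrepresentation.ofSubmodule'`, as in ★ LIFT `eq_zero_of_forall_cut_cyclic`).
Consumer: (K-c) `K2E3GL3OneLinkNestedHighKill` (the second peel kernel `K₂` of ★ `exists_peel_tower` is `⊥`).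

HONEST LABEL: HC_CM is proved only modulo the 7 printed citations (2 remaining named inputs: hLiu418 = stmt-HodgeConjecture-24832, h413 =
stmt-HodgeConjecture-24833) until rung 0 closes; count-neutral helper.

## References
* [BernsteinZelevinsky1977] I. N. Bernstein, A. V. Zelevinsky, *Induced representations of reductive p-adic groups I*, Ann. Sci. ÉNS 10 (1977), Prop. 1.9 (a), §2.3–2.4, Thm. 2.5, Thm. 2.9.
* [Casselman1995] W. Casselman, *Introduction to the theory of admissible representations of p-adic reductive groups* (draft 1995), Prop. 3.2.3, Thm. 5.1.2, Cor. 5.4.3, §6.3.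
-/

set_option autoImplicit false
-- the mandated namespace repeats `HodgeConjecture.HodgeConjecture`, as in every `Theorems/*.lean` of this sub-problem
set_option linter.dupNamespace false

noncomputable section

open Representation Function Literature.NumberTheory.Automorphic Literature.NumberTheory.GaloisRepresentations.IsNonarchimedeanLocalField
open Literature.RepresentationTheory.FiniteGroups Literature.RepresentationTheory.Semisimple
open scoped MatrixGroups
open Summit.HodgeConjecture.HodgeConjecture.Cruxes.H413.K2E3GL3JacquetLeviRelabel (exists_leviRelabel exists_jacquetRelabel jacquetRelabel_jacquetGL mem_cutUnipotent_of_blockDiagonalGL_mem)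
open Summit.HodgeConjecture.HodgeConjecture.Cruxes.H413.K2E3JacquetSubquotientNoCuspidal (intertwiningMap_subrepresentation_jacquetGL_eq_zero)
open Summit.HodgeConjecture.HodgeConjecture.Cruxes.H413.K2E3GL3JacquetInStagesBorel (mem_coinvariantsKer_subrepresentation_iff blockDiagonalGL_mulSingle_false_mem_unipotentRadicalGL)
open Summit.HodgeConjecture.HodgeConjecture.Cruxes.H413.K2E3GL3ExponentRules (isSmooth_normalizedJacquetGL)

namespace Summit.HodgeConjecture.HodgeConjecture.Cruxes.H413.K2E3JacquetSubquotientNoCuspidalBool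

variable {F : Type} [Field F] [ValuativeRel F] [TopologicalSpace F] [IsNonarchimedeanLocalField F]
  (e : Fin 2 ≃ {i : Fin 3 // (![false, false, true] : Fin 3 → Bool) i = false})
  (he : ∀ j : Fin 2, ((e j : {i : Fin 3 // (![false, false, true] : Fin 3 → Bool) i = false}) : Fin 3) = Fin.castSucc j)
  {XI X₁ X : Type} [AddCommGroup XI] [Module ℂ XI] [AddCommGroup X₁] [Module ℂ X₁] [AddCommGroup X] [Module ℂ X]
  (I : Representation ℂ (GL (Fin 3) F) XI) (ρ₁ : Representation ℂ (GL (Fin 3) F) X₁) (ρ : Representation ℂ (GL (Fin 3) F) X)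

include he in
set_option maxHeartbeats 6400000 in  -- one long transport proof over large Jacquet-module terms (cumulative budget for the whole declaration)
/-- **NO CUSPIDAL VECTORS IN `r_Q ρ` (finitely generated form, `Bool` currency).**  `I` smooth with the cell hypothesis at `c = ![0,0,1]`, `ρ` a smooth subquotient of `I`; a finitely
generated `M`-subrepresentation `W₂ ≤ r_Q ρ` all of whose vectors die under the stages map `p : r_Q ρ ↠ r_B ρ` is `⊥`.
[cite: BernsteinZelevinsky1977, Prop. 1.9 (a), Thm. 2.5, §2.4, Thm. 2.9] [cite: Casselman1995, Thm. 5.1.2, Cor. 5.4.3, §6.3] -/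
theorem subrepresentation_eq_bot_of_stagesMap_eq_zero (hI : I.IsSmooth)
    (hcell : ∀ (W : Type) [AddCommGroup W] [Module ℂ W] (σ : Representation ℂ (Π a, GL {i // (![0, 0, 1] : Fin 3 → Fin 2) i = a} F) W),
      σ.IsIrreducible → σ.IsSmooth → σ.IsSupercuspidal → ∀ (N : Subrepresentation (jacquetGL F (![0, 0, 1] : Fin 3 → Fin 2) I)) (q : N.toRepresentation.IntertwiningMap σ), q = 0)
    (ι₁ : ρ₁.IntertwiningMap I) (hι₁ : Function.Injective ι₁) (π₁ : ρ₁.IntertwiningMap ρ) (hπ₁ : Function.Surjective π₁) (hρ : ρ.IsSmooth)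
    (W₂ : Subrepresentation (jacquetGL F (![false, false, true] : Fin 3 → Bool) ρ)) [Module.Finite (MonoidAlgebra ℂ (Π a : Bool, GL {i : Fin 3 // (![false, false, true] : Fin 3 → Bool) i = a} F)) W₂.toRepresentation.asModule]
    (hp : ∀ y : (restrictUnipotentGL F (![false, false, true] : Fin 3 → Bool) ρ).Coinvariants, y ∈ W₂ → (Representation.Coinvariants.lift (restrictUnipotentGL F (![false, false, true] : Fin 3 → Bool) ρ) (Representation.Coinvariants.mk (restrictUnipotentGL F (id : Fin 3 → Fin 3) ρ)) (K2E3GL3JacquetInStagesBorel.mk_comp_restrictUnipotentGL_twoOne_eq ρ)) y = 0) :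
    W₂ = ⊥ := by
  classical
  haveI : IsTopologicalRing F := inferInstance
  by_contra hne
  haveI : Nontrivial ↥W₂.toSubmodule := Submodule.nontrivial_iff_ne_bot.2 fun h => hne (Subrepresentation.toSubmodule_injective h)
  -- an irreducible smooth quotient `σ = W₂ ⁄ N₂`
  obtain ⟨N₂, hN₂⟩ := Representation.exists_isCoatom_subrepresentation W₂.toRepresentation
  have hirr : N₂.quotientRep.IsIrreducible := Subrepresentation.isIrreducible_quotientRep hN₂
  have hsmJ : (jacquetGL F (![false, false, true] : Fin 3 → Bool) ρ).IsSmooth := hρ.jacquetGL F (![false, false, true] : Fin 3 → Bool)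
  have hsmW : W₂.toRepresentation.IsSmooth := hsmJ.toRepresentation W₂
  have hsm : N₂.quotientRep.IsSmooth := hsmW.quotientRep N₂
  -- (K-a): the relabellings `φ` and `Θ`
  obtain ⟨φ, hφ⟩ := exists_leviRelabel F
  obtain ⟨Θ, hΘ⟩ := exists_jacquetRelabel ρ
  -- the transported irreducible `σF = σ ∘ φ` on the `Fin 2`-Levi (kept opaque, with its defining equation)
  obtain ⟨σF, hσF⟩ : ∃ σF : Representation ℂ (Π a, GL {i // (![0, 0, 1] : Fin 3 → Fin 2) i = a} F) (↥W₂.toSubmodule ⧸ N₂.toSubmodule), σF = N₂.quotientRep.comp φ.toMulEquiv.toMonoidHom := ⟨_, rfl⟩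
  have hσFapply : ∀ (m : (Π a, GL {i // (![0, 0, 1] : Fin 3 → Fin 2) i = a} F)) (w : ↥W₂.toSubmodule ⧸ N₂.toSubmodule), σF m w = N₂.quotientRep (φ m) w := fun m w => by
    rw [hσF]; rfl
  haveI hσFirr : σF.IsIrreducible := by
    rw [hσF]; exact isIrreducible_comp_of_surjective N₂.quotientRep φ.toMulEquiv.toMonoidHom φ.toMulEquiv.surjective
  have hσFsm : σF.IsSmooth := by
    rw [hσF]; exact IsSmooth.comp_of_continuous N₂.quotientRep φ.toMulEquiv.toMonoidHom φ.continuous hsm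
  -- `W₂` as a subrepresentation of the NORMALISED Jacquet module (same carrier), for ★ p14's left exactness in the `GL₂`-slot
  have hnsm : (normalizedJacquetGL F (![false, false, true] : Fin 3 → Bool) ρ).IsSmooth := isSmooth_normalizedJacquetGL (![false, false, true] : Fin 3 → Bool) hρ
  have hW₂'mem : ∀ (m : (Π a : Bool, GL {i : Fin 3 // (![false, false, true] : Fin 3 → Bool) i = a} F)) (y : (restrictUnipotentGL F (![false, false, true] : Fin 3 → Bool) ρ).Coinvariants), y ∈ W₂.toSubmodule → (normalizedJacquetGL F (![false, false, true] : Fin 3 → Bool) ρ) m y ∈ W₂.toSubmodule := by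
    intro m y hy
    change ((jacquetGL F (![false, false, true] : Fin 3 → Bool) ρ).twist (((rootDeltaChar (standardParabolicGL F (![false, false, true] : Fin 3 → Bool)))⁻¹).comp (leviEmbeddingP F (![false, false, true] : Fin 3 → Bool)))) m y ∈ W₂.toSubmodule
    rw [Representation.twist_apply]
    exact W₂.toSubmodule.smul_mem _ (W₂.apply_mem_toSubmodule m hy)
  obtain ⟨W₂', hW₂'⟩ : ∃ W₂' : Subrepresentation (normalizedJacquetGL F (![false, false, true] : Fin 3 → Bool) ρ), W₂'.toSubmodule = W₂.toSubmodule := ⟨⟨W₂.toSubmodule, hW₂'mem⟩, rfl⟩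
  have hkerU : ∀ y : ↥W₂'.toSubmodule, y ∈ Coinvariants.ker (restrictUnipotentGL F (id : Fin 2 → Fin 2) (W₂'.toRepresentation.comp ((MonoidHom.mulSingle (fun a : Bool => GL {i : Fin 3 // (![false, false, true] : Fin 3 → Bool) i = a} F) false).comp (reindexGL e).toMonoidHom) : Representation ℂ (GL (Fin 2) F) ↥W₂'.toSubmodule)) :=
    fun y => (mem_coinvariantsKer_subrepresentation_iff e he ρ hnsm W₂' y).2 (hp y ((SetLike.ext_iff.1 hW₂' (y : (restrictUnipotentGL F (![false, false, true] : Fin 3 → Bool) ρ).Coinvariants)).1 y.2))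
  -- every class `[y]`, `y ∈ W₂`, lies in the cut-Jacquet kernel of `σF`
  have hcut : ∀ y : ↥W₂.toSubmodule, Submodule.Quotient.mk (p := N₂.toSubmodule) y ∈ Coinvariants.ker (σF.comp (cutUnipotent F (![0, 0, 1] : Fin 3 → Fin 2) 0).subtype) := by
    intro y
    -- the linear map `L : W₂' → W₂ ⁄ N₂`, `y ↦ [y]`
    obtain ⟨L, hL⟩ : ∃ L : ↥W₂'.toSubmodule →ₗ[ℂ] (↥W₂.toSubmodule ⧸ N₂.toSubmodule),
        ∀ (z : (restrictUnipotentGL F (![false, false, true] : Fin 3 → Bool) ρ).Coinvariants) (hz' : z ∈ W₂'.toSubmodule) (hz : z ∈ W₂.toSubmodule), L ⟨z, hz'⟩ = Submodule.Quotient.mk ⟨z, hz⟩ :=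
      ⟨N₂.toSubmodule.mkQ ∘ₗ (LinearEquiv.ofEq _ _ hW₂' : ↥W₂'.toSubmodule ≃ₗ[ℂ] ↥W₂.toSubmodule).toLinearMap, fun z hz' hz => rfl⟩
    have hyW' : (y : (restrictUnipotentGL F (![false, false, true] : Fin 3 → Bool) ρ).Coinvariants) ∈ W₂'.toSubmodule := by rw [hW₂']; exact y.2
    have hy := hkerU ⟨y, hyW'⟩
    rw [Coinvariants.ker] at hy
    have hy' := (Submodule.span_le.2 ?_ : _ ≤ (Coinvariants.ker (σF.comp (cutUnipotent F (![0, 0, 1] : Fin 3 → Fin 2) 0).subtype)).comap L) hy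
    · rw [Submodule.mem_comap, hL (y : (restrictUnipotentGL F (![false, false, true] : Fin 3 → Bool) ρ).Coinvariants) hyW' y.2] at hy'
      exact hy'
    rintro _ ⟨⟨u, v⟩, rfl⟩
    rw [SetLike.mem_coe, Submodule.mem_comap]
    -- the generator `(W₂' ∘ ι)(u) v − v`, `u ∈ U₂`
    have hu : ((u : ↥(standardParabolicGL F (id : Fin 2 → Fin 2))) : GL (Fin 2) F) ∈ unipotentRadicalGL F (id : Fin 2 → Fin 2) :=
      (K2E3GL3OuterAutomorphismInduction.mem_unipotentRadicalP_iff F (id : Fin 2 → Fin 2) (u : ↥(standardParabolicGL F (id : Fin 2 → Fin 2)))).1 u.2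
    have hex : ∃ m : (Π a, GL {i // (![0, 0, 1] : Fin 3 → Fin 2) i = a} F), φ m = ((MonoidHom.mulSingle (fun a : Bool => GL {i : Fin 3 // (![false, false, true] : Fin 3 → Bool) i = a} F) false).comp (reindexGL e).toMonoidHom) ((u : ↥(standardParabolicGL F (id : Fin 2 → Fin 2))) : GL (Fin 2) F) := ⟨φ.symm _, φ.apply_symm_apply _⟩
    rcases hex with ⟨m, hmφ⟩
    have hmcut : m ∈ cutUnipotent F (![0, 0, 1] : Fin 3 → Fin 2) 0 := by
      refine mem_cutUnipotent_of_blockDiagonalGL_mem m ?_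
      rw [← hφ m, hmφ]
      exact blockDiagonalGL_mulSingle_false_mem_unipotentRadicalGL e he _ hu
    -- the value of the generator in `r_Q ρ`: the normalised and unnormalised actions of `ι u` agree (`δ(ι u) = 1`)
    have hv₂ : (v : (restrictUnipotentGL F (![false, false, true] : Fin 3 → Bool) ρ).Coinvariants) ∈ W₂.toSubmodule := by rw [← hW₂']; exact v.2
    have hval : ((restrictUnipotentGL F (id : Fin 2 → Fin 2) (W₂'.toRepresentation.comp ((MonoidHom.mulSingle (fun a : Bool => GL {i : Fin 3 // (![false, false, true] : Fin 3 → Bool) i = a} F) false).comp (reindexGL e).toMonoidHom) : Representation ℂ (GL (Fin 2) F) ↥W₂'.toSubmodule) u v : ↥W₂'.toSubmodule) : (restrictUnipotentGL F (![false, false, true] : Fin 3 → Bool) ρ).Coinvariants) = (jacquetGL F (![false, false, true] : Fin 3 → Bool) ρ) (φ m) (v : (restrictUnipotentGL F (![false, false, true] : Fin 3 → Bool) ρ).Coinvariants) := by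
      change (normalizedJacquetGL F (![false, false, true] : Fin 3 → Bool) ρ) (((MonoidHom.mulSingle (fun a : Bool => GL {i : Fin 3 // (![false, false, true] : Fin 3 → Bool) i = a} F) false).comp (reindexGL e).toMonoidHom) ((u : ↥(standardParabolicGL F (id : Fin 2 → Fin 2))) : GL (Fin 2) F)) (v : (restrictUnipotentGL F (![false, false, true] : Fin 3 → Bool) ρ).Coinvariants) = (jacquetGL F (![false, false, true] : Fin 3 → Bool) ρ) (φ m) (v : (restrictUnipotentGL F (![false, false, true] : Fin 3 → Bool) ρ).Coinvariants)
      rw [hmφ]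
      obtain ⟨x, hx⟩ := Coinvariants.mk_surjective (restrictUnipotentGL F (![false, false, true] : Fin 3 → Bool) ρ) (v : (restrictUnipotentGL F (![false, false, true] : Fin 3 → Bool) ρ).Coinvariants)
      rw [← hx, MonoidHom.comp_apply, MulEquiv.coe_toMonoidHom, MonoidHom.mulSingle_apply,
        K2E3GL3JacquetInStagesBorel.normalizedJacquetGL_blockEmbedding_mk_of_mem_unipotentRadicalGL e ρ _ hu x, jacquetGL_mk]
    have hmemφ : (jacquetGL F (![false, false, true] : Fin 3 → Bool) ρ) (φ m) (v : (restrictUnipotentGL F (![false, false, true] : Fin 3 → Bool) ρ).Coinvariants) ∈ W₂.toSubmodule := W₂.apply_mem_toSubmodule (φ m) hv₂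
    have hgenW' : ((restrictUnipotentGL F (id : Fin 2 → Fin 2) (W₂'.toRepresentation.comp ((MonoidHom.mulSingle (fun a : Bool => GL {i : Fin 3 // (![false, false, true] : Fin 3 → Bool) i = a} F) false).comp (reindexGL e).toMonoidHom) : Representation ℂ (GL (Fin 2) F) ↥W₂'.toSubmodule) u v - v : ↥W₂'.toSubmodule) : (restrictUnipotentGL F (![false, false, true] : Fin 3 → Bool) ρ).Coinvariants) ∈ W₂'.toSubmodule :=
      (restrictUnipotentGL F (id : Fin 2 → Fin 2) (W₂'.toRepresentation.comp ((MonoidHom.mulSingle (fun a : Bool => GL {i : Fin 3 // (![false, false, true] : Fin 3 → Bool) i = a} F) false).comp (reindexGL e).toMonoidHom) : Representation ℂ (GL (Fin 2) F) ↥W₂'.toSubmodule) u v - v).2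
    have hgenW : ((restrictUnipotentGL F (id : Fin 2 → Fin 2) (W₂'.toRepresentation.comp ((MonoidHom.mulSingle (fun a : Bool => GL {i : Fin 3 // (![false, false, true] : Fin 3 → Bool) i = a} F) false).comp (reindexGL e).toMonoidHom) : Representation ℂ (GL (Fin 2) F) ↥W₂'.toSubmodule) u v - v : ↥W₂'.toSubmodule) : (restrictUnipotentGL F (![false, false, true] : Fin 3 → Bool) ρ).Coinvariants) ∈ W₂.toSubmodule := by
      rw [← hW₂']; exact hgenW'
    have hLgen : L (restrictUnipotentGL F (id : Fin 2 → Fin 2) (W₂'.toRepresentation.comp ((MonoidHom.mulSingle (fun a : Bool => GL {i : Fin 3 // (![false, false, true] : Fin 3 → Bool) i = a} F) false).comp (reindexGL e).toMonoidHom) : Representation ℂ (GL (Fin 2) F) ↥W₂'.toSubmodule) u v - v) =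
        Submodule.Quotient.mk (W₂.toRepresentation (φ m) ⟨(v : (restrictUnipotentGL F (![false, false, true] : Fin 3 → Bool) ρ).Coinvariants), hv₂⟩) - Submodule.Quotient.mk ⟨(v : (restrictUnipotentGL F (![false, false, true] : Fin 3 → Bool) ρ).Coinvariants), hv₂⟩ := by
      have h1 : L (restrictUnipotentGL F (id : Fin 2 → Fin 2) (W₂'.toRepresentation.comp ((MonoidHom.mulSingle (fun a : Bool => GL {i : Fin 3 // (![false, false, true] : Fin 3 → Bool) i = a} F) false).comp (reindexGL e).toMonoidHom) : Representation ℂ (GL (Fin 2) F) ↥W₂'.toSubmodule) u v - v) = Submodule.Quotient.mk ⟨_, hgenW⟩ := hL _ hgenW' hgenW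
      rw [h1, ← Submodule.Quotient.mk_sub]
      congr 1
      apply Subtype.ext
      change ((restrictUnipotentGL F (id : Fin 2 → Fin 2) (W₂'.toRepresentation.comp ((MonoidHom.mulSingle (fun a : Bool => GL {i : Fin 3 // (![false, false, true] : Fin 3 → Bool) i = a} F) false).comp (reindexGL e).toMonoidHom) : Representation ℂ (GL (Fin 2) F) ↥W₂'.toSubmodule) u v : ↥W₂'.toSubmodule) : (restrictUnipotentGL F (![false, false, true] : Fin 3 → Bool) ρ).Coinvariants) - (v : (restrictUnipotentGL F (![false, false, true] : Fin 3 → Bool) ρ).Coinvariants) = (jacquetGL F (![false, false, true] : Fin 3 → Bool) ρ) (φ m) (v : (restrictUnipotentGL F (![false, false, true] : Fin 3 → Bool) ρ).Coinvariants) - (v : (restrictUnipotentGL F (![false, false, true] : Fin 3 → Bool) ρ).Coinvariants)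
      rw [hval]
    have hfin : (σF.comp (cutUnipotent F (![0, 0, 1] : Fin 3 → Fin 2) 0).subtype) ⟨m, hmcut⟩ (Submodule.Quotient.mk ⟨(v : (restrictUnipotentGL F (![false, false, true] : Fin 3 → Bool) ρ).Coinvariants), hv₂⟩) =
        Submodule.Quotient.mk (W₂.toRepresentation (φ m) ⟨(v : (restrictUnipotentGL F (![false, false, true] : Fin 3 → Bool) ρ).Coinvariants), hv₂⟩) := by
      show σF m (Submodule.Quotient.mk ⟨(v : (restrictUnipotentGL F (![false, false, true] : Fin 3 → Bool) ρ).Coinvariants), hv₂⟩) = _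
      rw [hσFapply, Subrepresentation.quotientRep_mk]
    have hmem := Coinvariants.sub_mem_ker (ρ := σF.comp (cutUnipotent F (![0, 0, 1] : Fin 3 → Fin 2) 0).subtype) ⟨m, hmcut⟩ (Submodule.Quotient.mk ⟨(v : (restrictUnipotentGL F (![false, false, true] : Fin 3 → Bool) ρ).Coinvariants), hv₂⟩)
    rw [hfin] at hmem
    show L (restrictUnipotentGL F (id : Fin 2 → Fin 2) (W₂'.toRepresentation.comp ((MonoidHom.mulSingle (fun a : Bool => GL {i : Fin 3 // (![false, false, true] : Fin 3 → Bool) i = a} F) false).comp (reindexGL e).toMonoidHom) : Representation ℂ (GL (Fin 2) F) ↥W₂'.toSubmodule) u v - v) ∈ Coinvariants.ker (σF.comp (cutUnipotent F (![0, 0, 1] : Fin 3 → Fin 2) 0).subtype)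
    rw [hLgen]
    exact hmem
  have hσFsc : σF.IsSupercuspidal := by
    refine isSupercuspidal_of_forall_cut σF K2E3GL3MaximalParabolicRelabel.monotone_twoOne hσFsm fun p q hpq hcq => ?_
    have hp0 : p = 0 := by
      revert hpq hcq; fin_cases p <;> fin_cases q <;> decide
    subst hp0
    refine eq_top_iff.2 fun w _ => ?_
    obtain ⟨y, rfl⟩ := Submodule.Quotient.mk_surjective N₂.toSubmodule w
    exact hcut y
  -- transport `W₂` along `Θ` to a `Fin 2`-currency subrepresentation `W′ ≤ jacquetGL F ![0,0,1] ρ`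
  have hW'stab : ∀ (m : (Π a, GL {i // (![0, 0, 1] : Fin 3 → Fin 2) i = a} F)) (w : (restrictUnipotentGL F (![0, 0, 1] : Fin 3 → Fin 2) ρ).Coinvariants),
      w ∈ W₂.toSubmodule.map (Θ : (restrictUnipotentGL F (![false, false, true] : Fin 3 → Bool) ρ).Coinvariants →ₗ[ℂ] (restrictUnipotentGL F (![0, 0, 1] : Fin 3 → Fin 2) ρ).Coinvariants) → jacquetGL F (![0, 0, 1] : Fin 3 → Fin 2) ρ m w ∈ W₂.toSubmodule.map (Θ : (restrictUnipotentGL F (![false, false, true] : Fin 3 → Bool) ρ).Coinvariants →ₗ[ℂ] (restrictUnipotentGL F (![0, 0, 1] : Fin 3 → Fin 2) ρ).Coinvariants) := by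
    intro m w hw
    obtain ⟨y, hy, rfl⟩ := Submodule.mem_map.1 hw
    refine Submodule.mem_map.2 ⟨jacquetGL F (![false, false, true] : Fin 3 → Bool) ρ (φ m) y, W₂.apply_mem_toSubmodule (φ m) hy, ?_⟩
    exact jacquetRelabel_jacquetGL ρ φ hφ Θ hΘ m y
  obtain ⟨W', hW'⟩ : ∃ W' : Subrepresentation (jacquetGL F (![0, 0, 1] : Fin 3 → Fin 2) ρ), W'.toSubmodule = W₂.toSubmodule.map (Θ : (restrictUnipotentGL F (![false, false, true] : Fin 3 → Bool) ρ).Coinvariants →ₗ[ℂ] (restrictUnipotentGL F (![0, 0, 1] : Fin 3 → Fin 2) ρ).Coinvariants) :=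
    ⟨⟨_, hW'stab⟩, rfl⟩
  have hW'mem : ∀ w : ↥W'.toSubmodule, Θ.symm (w : (restrictUnipotentGL F (![0, 0, 1] : Fin 3 → Fin 2) ρ).Coinvariants) ∈ W₂.toSubmodule := by
    rintro ⟨w, hw⟩
    rw [hW'] at hw
    obtain ⟨y, hy, rfl⟩ := Submodule.mem_map.1 hw
    change Θ.symm (Θ y) ∈ _
    rw [LinearEquiv.symm_apply_apply]
    exact hy
  -- the non-zero intertwining map `f : W′ → σF`, `w ↦ [Θ⁻¹ w]`
  obtain ⟨g, hg⟩ : ∃ g : ↥W'.toSubmodule →ₗ[ℂ] ↥W₂.toSubmodule, ∀ w, ((g w : ↥W₂.toSubmodule) : (restrictUnipotentGL F (![false, false, true] : Fin 3 → Bool) ρ).Coinvariants) = Θ.symm (w : (restrictUnipotentGL F (![0, 0, 1] : Fin 3 → Fin 2) ρ).Coinvariants) :=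
    ⟨{ toFun := fun w => ⟨Θ.symm (w : (restrictUnipotentGL F (![0, 0, 1] : Fin 3 → Fin 2) ρ).Coinvariants), hW'mem w⟩
       map_add' := fun a b => Subtype.ext (by simp)
       map_smul' := fun a w => Subtype.ext (by simp) }, fun w => rfl⟩
  have hgact : ∀ (m : (Π a, GL {i // (![0, 0, 1] : Fin 3 → Fin 2) i = a} F)) (w : ↥W'.toSubmodule), g (W'.toRepresentation m w) = W₂.toRepresentation (φ m) (g w) := by
    intro m w
    apply Subtype.ext
    rw [hg]
    change Θ.symm (jacquetGL F (![0, 0, 1] : Fin 3 → Fin 2) ρ m (w : (restrictUnipotentGL F (![0, 0, 1] : Fin 3 → Fin 2) ρ).Coinvariants)) = jacquetGL F (![false, false, true] : Fin 3 → Bool) ρ (φ m) ((g w : ↥W₂.toSubmodule) : (restrictUnipotentGL F (![false, false, true] : Fin 3 → Bool) ρ).Coinvariants)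
    rw [hg]
    apply Θ.injective
    rw [LinearEquiv.apply_symm_apply, jacquetRelabel_jacquetGL ρ φ hφ Θ hΘ m, LinearEquiv.apply_symm_apply]
  have hfint : ∀ (m : (Π a, GL {i // (![0, 0, 1] : Fin 3 → Fin 2) i = a} F)) (w : ↥W'.toSubmodule), N₂.toSubmodule.mkQ (g (W'.toRepresentation m w)) = σF m (N₂.toSubmodule.mkQ (g w)) := by
    intro m w
    rw [hgact, Submodule.mkQ_apply, Submodule.mkQ_apply, hσFapply, Subrepresentation.quotientRep_mk]
  obtain ⟨f, hf⟩ : ∃ f : W'.toRepresentation.IntertwiningMap σF, ∀ w, f w = N₂.toSubmodule.mkQ (g w) :=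
    ⟨{ toLinearMap := N₂.toSubmodule.mkQ ∘ₗ g
       isIntertwining' := fun m => LinearMap.ext fun w => hfint m w }, fun w => rfl⟩
  have hf0 : f = 0 :=
    intertwiningMap_subrepresentation_jacquetGL_eq_zero I ρ₁ ρ K2E3GL3MaximalParabolicRelabel.monotone_twoOne hI hcell ι₁ hι₁ π₁ hπ₁ W' σF hσFirr hσFsm hσFsc f
  -- but `f (Θ y) = [y] ≠ 0` for a vector `y ∈ W₂` with non-zero class
  haveI : Nontrivial (↥W₂.toSubmodule ⧸ N₂.toSubmodule) := Representation.IsIrreducible.nontrivial N₂.quotientRep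
  obtain ⟨z, hz⟩ := exists_ne (0 : ↥W₂.toSubmodule ⧸ N₂.toSubmodule)
  obtain ⟨y, rfl⟩ := Submodule.Quotient.mk_surjective N₂.toSubmodule z
  have hyW' : Θ (y : (restrictUnipotentGL F (![false, false, true] : Fin 3 → Bool) ρ).Coinvariants) ∈ W'.toSubmodule := by rw [hW']; exact Submodule.mem_map.2 ⟨y, y.2, rfl⟩
  have h1 : f ⟨Θ (y : (restrictUnipotentGL F (![false, false, true] : Fin 3 → Bool) ρ).Coinvariants), hyW'⟩ = 0 := by rw [hf0]; rfl
  have h2 : f ⟨Θ (y : (restrictUnipotentGL F (![false, false, true] : Fin 3 → Bool) ρ).Coinvariants), hyW'⟩ = Submodule.Quotient.mk y := by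
    rw [hf, Submodule.mkQ_apply]
    congr 1
    apply Subtype.ext
    rw [hg]
    exact LinearEquiv.symm_apply_apply Θ _
  exact hz (h2.symm.trans h1)

include he in
/-- **NO CUSPIDAL VECTORS IN `r_Q ρ`, cyclic form (`Bool` currency)**: a vector of `r_Q ρ` whose cyclic `M`-span dies under the stages map `p : r_Q ρ ↠ r_B ρ` is `0`.
[cite: BernsteinZelevinsky1977, Thm. 2.5, §2.4, Thm. 2.9] [cite: Casselman1995, Cor. 5.4.3, §6.3] -/
theorem eq_zero_of_stagesMap_cyclic_eq_zero (hI : I.IsSmooth)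
    (hcell : ∀ (W : Type) [AddCommGroup W] [Module ℂ W] (σ : Representation ℂ (Π a, GL {i // (![0, 0, 1] : Fin 3 → Fin 2) i = a} F) W),
      σ.IsIrreducible → σ.IsSmooth → σ.IsSupercuspidal → ∀ (N : Subrepresentation (jacquetGL F (![0, 0, 1] : Fin 3 → Fin 2) I)) (q : N.toRepresentation.IntertwiningMap σ), q = 0)
    (ι₁ : ρ₁.IntertwiningMap I) (hι₁ : Function.Injective ι₁) (π₁ : ρ₁.IntertwiningMap ρ) (hπ₁ : Function.Surjective π₁) (hρ : ρ.IsSmooth)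
    (x : (restrictUnipotentGL F (![false, false, true] : Fin 3 → Bool) ρ).Coinvariants)
    (hp : ∀ y : (restrictUnipotentGL F (![false, false, true] : Fin 3 → Bool) ρ).Coinvariants,
      y ∈ (Subrepresentation.ofSubmodule' (ρ := jacquetGL F (![false, false, true] : Fin 3 → Bool) ρ) (Submodule.span (MonoidAlgebra ℂ (Π a : Bool, GL {i : Fin 3 // (![false, false, true] : Fin 3 → Bool) i = a} F)) {(jacquetGL F (![false, false, true] : Fin 3 → Bool) ρ).asModuleEquiv.symm x})) →
        (Representation.Coinvariants.lift (restrictUnipotentGL F (![false, false, true] : Fin 3 → Bool) ρ) (Representation.Coinvariants.mk (restrictUnipotentGL F (id : Fin 3 → Fin 3) ρ)) (K2E3GL3JacquetInStagesBorel.mk_comp_restrictUnipotentGL_twoOne_eq ρ)) y = 0) :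
    x = 0 := by
  set S : Submodule (MonoidAlgebra ℂ (Π a : Bool, GL {i : Fin 3 // (![false, false, true] : Fin 3 → Bool) i = a} F)) (jacquetGL F (![false, false, true] : Fin 3 → Bool) ρ).asModule :=
    Submodule.span (MonoidAlgebra ℂ (Π a : Bool, GL {i : Fin 3 // (![false, false, true] : Fin 3 → Bool) i = a} F)) {(jacquetGL F (![false, false, true] : Fin 3 → Bool) ρ).asModuleEquiv.symm x} with hS
  set C : Subrepresentation (jacquetGL F (![false, false, true] : Fin 3 → Bool) ρ) := Subrepresentation.ofSubmodule' S with hC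
  have hxS : (jacquetGL F (![false, false, true] : Fin 3 → Bool) ρ).asModuleEquiv.symm x ∈ S := Submodule.subset_span (Set.mem_singleton _)
  have hxC : x ∈ C := hxS
  haveI : Module.Finite (MonoidAlgebra ℂ (Π a : Bool, GL {i : Fin 3 // (![false, false, true] : Fin 3 → Bool) i = a} F)) ↥S := Module.Finite.span_singleton _ _
  have hS' : S = C.asSubmodule := rfl
  haveI : Module.Finite (MonoidAlgebra ℂ (Π a : Bool, GL {i : Fin 3 // (![false, false, true] : Fin 3 → Bool) i = a} F)) C.toRepresentation.asModule :=
    Module.Finite.equiv ((LinearEquiv.ofEq _ _ hS').trans (Subrepresentation.asModuleEquiv C).symm)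
  have hbot := subrepresentation_eq_bot_of_stagesMap_eq_zero e he I ρ₁ ρ hI hcell ι₁ hι₁ π₁ hπ₁ hρ C hp
  have : x ∈ (⊥ : Subrepresentation (jacquetGL F (![false, false, true] : Fin 3 → Bool) ρ)) := hbot ▸ hxC
  exact this

end Summit.HodgeConjecture.HodgeConjecture.Cruxes.H413.K2E3JacquetSubquotientNoCuspidalBool

end
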